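import Summits.Ventures.PercRepro.ProfileGapMonoThresholdNullityThreeTop

/-!
# PercRepro — COROLLARIES OF THE NULLITY-`3` THEOREM: the core form and the row `(3, 4)` at rank `5` (p5, gen 31;
`proofs/P5-GM1.md` §43(g))

With TopCore's climb, the nullity-`3` theorem holds on every matroid whose coloop-free core (the deletion of a finset
of coloops and loops) has nullity `3` and rank `≥ 4` (`thresholdIneq_four_top_of_core_nullity_three`).  At rank `5` the
top threshold `t = 4` is the offset-`0` statement `(I_4)`, which is the row `(3, 4)` (§23): on every coloop-free
rank-`5` matroid with `8` points the row `(3, 4)` of `Π⁻` and of `Π` holds (`profileIneqMinusQ_three_four_of_nullity_three`,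
`profileIneq_three_four_of_nullity_three`) — the first row `(3, 4)` theorem at rank `> 4` with a long plane allowed.
Nothing open is asserted.
-/

open scoped Matroid

namespace PercRepro.Cogirth

open Finset ThmH Skew Shadow Profile

variable {α : Type} [DecidableEq α] {N : Matroid α} [N.Finite]

/-- **The nullity-`3` theorem on every matroid whose core qualifies**: `W ⊆ E` a finset of coloops and loops of
`N`, the core `N ∖ W` coloop-free of rank `≥ 4` with `#(E ∖ W) = ρ(N ∖ W) + 3`. -/
theorem thresholdIneq_four_top_of_core_nullity_three {W : Finset α} (hW : W ⊆ gr N)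
    (hcl : ∀ z ∈ W, rk N ((gr N).erase z) + 1 = rk N (gr N) ∨ rk N {z} = 0)
    (hcf : ∀ z ∈ gr (N ＼ (W : Set α)), rk (N ＼ (W : Set α)) ((gr (N ＼ (W : Set α))).erase z) =
      rk (N ＼ (W : Set α)) (gr (N ＼ (W : Set α))))
    (hn : (gr (N ＼ (W : Set α))).card = rk (N ＼ (W : Set α)) (gr (N ＼ (W : Set α))) + 3)
    (hR : 4 ≤ rk (N ＼ (W : Set α)) (gr (N ＼ (W : Set α)))) : ThresholdIneq N 4 (rk N (gr N) - 1) :=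
  thresholdIneq_top_of_delete_core (by norm_num) W N hW hcl (by omega)
    (thresholdIneq_four_top_of_nullity_three hcf hn hR)

/-- **THE ROW `(3, 4)` OF `Π⁻` ON EVERY COLOOP-FREE RANK-`5` MATROID WITH `8` POINTS**: the top threshold `t = 4` is
`(I_4) ⟺ (I_3)`, the row. -/
theorem profileIneqMinusQ_three_four_of_nullity_three (hcf : ∀ z ∈ gr N, rk N ((gr N).erase z) = rk N (gr N))
    (hR : rk N (gr N) = 5) (hn : (gr N).card = 8) : ProfileIneqMinusQ N 3 4 := by
  have h := thresholdIneq_four_top_of_nullity_three hcf (by omega) (by omega)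
  rw [hR] at h
  have h' : ThresholdIneq N 4 (4 - 1) := (thresholdIneq_pred_iff (by norm_num)).2 h
  exact (thresholdIneq_iff_row (by norm_num)).1 h'

/-- **THE ROW `(Π_{3,4})` ON EVERY COLOOP-FREE RANK-`5` MATROID WITH `8` POINTS.** -/
theorem profileIneq_three_four_of_nullity_three (hcf : ∀ z ∈ gr N, rk N ((gr N).erase z) = rk N (gr N))
    (hR : rk N (gr N) = 5) (hn : (gr N).card = 8) : ProfileIneq N 3 4 :=
  profileIneq_of_minusQ (by norm_num) (profileIneqMinusQ_three_four_of_nullity_three hcf hR hn)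

end PercRepro.Cogirth
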